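import Summits.BirchSwinnertonDyer.BirchSwinnertonDyer.Theorems.ErratumRoadFiveEulerHalfGenusSharpKolyvaginOrder
import Literature.NumberTheory.EllipticCurves.HeegnerPointsKolyvaginPrimaryPointsProofs
import HarnessLib

/-!
# Kolyvagin's bound REFINED BY GLOBAL DIVISIBILITY for an ABSTRACT Euler system of Heegner-type POINTS attached to a
# non-torsion point `P ∈ E(K)` of finite index: `ord_p #Ш(E/K)[p^∞] + 2t ≤ 2·ord_p [E(K) : ℤP]`
# (crux stmt-BirchSwinnertonDyer-23444 `EulerHalfPOnlyMultPotMultTwinAtFive`, line `genus`, stub S4♭; helper)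

Cell `bsd-stepL` (run/shared/lean/pub/bsd-stepL/), seat `bsd-stepL-genus-p2` (prover g0). Sequel of parts 1–4
(`…GenusSharpKolyvagin{Bound,Sha,AtPrime,Order}`); sharp twin of bsd-addord's
`AbstractKolyvaginOrder.card_sha_primaryComponent_dvd_pow_index_of_points` (MultLower U-b), whose `hpoints` binder is —
up to the ADDED divisibility clause (D) — bsd-addord's ∕ bsd-stepL's ring-class-rational Kolyvagin currency MINUS the
embeddings (`GenusKolyvaginPointsR` of line `genus` §0 carries the same data plus `emb`, minus the Selmer clause).

## What

`padicValNat_card_sha_primaryComponent_add_le_of_sharpPoints` — for `E/ℚ` elliptic of conductor `N₀`, `K` imaginary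
quadratic, `p` odd with `ρ̄_{E,p}` onto, `P` non-torsion of finite index, depth `t`: GRANTED the point-level datum `hpoints`
with the Selmer clause at every `v ∤ m` and the divisibility (D) «`p^{M − t}` kills the Kolyvagin class of `P_m`» at every
level `p^M`: `Ш(E/K)[p^∞]` is finite and `ord_p #Ш(E/K)[p^∞] + 2t ≤ 2·ord_p [E(K) : ℤP]`. With
`t = ord_p ∏_ℓ c_ℓ(E)` this is EXACTLY the Tamagawa-sharpened («Jetchev») inequality that S4♭ asserts for the genus system,
so S4♭ ⟸ (this theorem) ∘ «the genus datum of `GenusKolyvaginPointsR` is Selmer at the carrier `v ∣ p` and globally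
`p^{ord_p ∏c(W)}`-divisible» — the research residual of line `genus` (Jetchev 2008 Thm. 1.4 READ at `p ∥ N` for the
genus system), recorded in the seat's census; see the sequel `…GenusSharpKolyvaginReduction` for the glue in S4♭'s binders.
-- adapted from Summits/BirchSwinnertonDyer/BirchSwinnertonDyer/Theorems/AdditiveBranchIMCGordTwoRankZeroOffCaseOneAbstractKolyvaginDivisibility.lean

## Honest framing

THEOREMS ONLY (no `def`, no named fact, no `sorry`; axioms standard). CONDITIONAL only on the displayed `hpoints`. Nothing
here constructs the genus system or proves (D) for it: stub S4♭ and item 23444 stay OPEN; BSD is proved for no curve.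

References: [cite: McCallumLMS1991, §1 Theorem, §4 (4)–(6), Cor. 4.5, Lemma 5.1, Thm. 5.4, Cor. 5.6 (p. 310)]
[cite: Jetchev2008, Thm. 1.4, p. 812 (1), Cor. 1.5] [cite: GrossLMS1991, §2 Prop. 2.1, §§3–8, §10]
[cite: MilneADT2006, Ch. I Thm. 4.10(b), §6]. presearch: as in part 1; tree `lean search 'add_le_of_sharpPoints'` → none.
-/

noncomputable section

open scoped Classical Pointwise

-- every file of `Summits/BirchSwinnertonDyer/BirchSwinnertonDyer/Theorems/` lives in this namespace
set_option linter.dupNamespace false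

namespace Summit.BirchSwinnertonDyer.BirchSwinnertonDyer.Theorems.GenusSharpKolyvagin
open WeierstrassCurve NumberField IsDedekindDomain Field Function
open Literature.NumberTheory.EllipticCurves Literature.NumberTheory.EllipticCurves.KolyvaginDescent
open Literature.NumberTheory.GaloisRepresentations
open Literature.NumberTheory.GaloisCohomology
open Literature.NumberTheory.GaloisRepresentations.DiscreteGaloisModule (mu MuCarrier)
open Summit.BirchSwinnertonDyer.Rank1Residual.X11b
open Summit.BirchSwinnertonDyer.Rank1Residual.X11b.KolyvaginCT
open Summit.BirchSwinnertonDyer.BirchSwinnertonDyer.Theorems.ShimuraKolyvaginOrder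

variable (W : WeierstrassCurve ℚ) {K : Type} [Field K] [NumberField K]

/-- **Kolyvagin's bound REFINED by global divisibility for an ABSTRACT Euler system of Heegner type (POINT level)
attached to a point of finite index**: `Ш(E/K)[p^∞]` finite and `ord_p #Ш(E/K)[p^∞] + 2t ≤ 2·ord_p [E(K) : ℤP]`, GRANTED
only `hpoints` — McCallum §4's derivative data for some Euler system of Heegner-type points of `E` over the ring class
fields of `K`, modulo every `p^M` (admissible modules `A m`, points `P_m ∈ invPoints (A m) p^M` with `P_1 = P`, the eigen
relation under a lift of complex conjugation, the Selmer condition of the Kolyvagin class at EVERY `v ∤ m`, McCallum's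
Prop. 4.4 switch at `λ ∣ m` — the hypothesis of the tree's `…_of_points` VERBATIM) PLUS (D): the Kolyvagin class
`c_M(m)` of `P_m` is killed by `p^{M − t}` (for points: `P_m ∈ p^t E(K_m) + (p^M A_m)`-type divisibility, McCallum
(5)–(6), Cor. 4.5; Jetchev's `m(c) ≥ t`). The classes are McCallum's cocycle (explicit here, so that (D) transfers), the
duality leaves (B), (B₂) come from Kolyvagin reciprocity = Poitou–Tate (`kolyvaginReciprocityFinset_of_poitouTate_of_conductorNorm`,
`poitouTate_sum_localTatePairing_eq_zero_holds`); then `padicValNat_card_sha_primaryComponent_add_le_of_sharpLeaves`.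
[cite: McCallumLMS1991, §1 Theorem (Kolyvagin), §2 Prop. 2.2, §4 (4)–(6), Cor. 4.5, Thm. 5.4, Cor. 5.6]
[cite: Jetchev2008, p. 812 (1), Cor. 1.5] [cite: GrossLMS1991, §2 Prop. 2.1, §§3–8, §10] [cite: MilneADT2006, Ch. I Thm. 4.10(b)] -/
theorem padicValNat_card_sha_primaryComponent_add_le_of_sharpPoints [W.IsElliptic]
    (hK : IsImaginaryQuadratic K) {N₀ : ℕ} [NeZero N₀] (hN : W.conductorNorm ℤ = N₀)
    {Pt : (W.baseChange K).toAffine.Point} {p : ℕ}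
    (hnt : ¬ IsOfFinAddOrder Pt) (hp : p.Prime) (hp2 : p ≠ 2)
    (hρ : W.HasSurjectiveModNGaloisRep p)
    (hidx : (AddSubgroup.zmultiples Pt).index ≠ 0) (t : ℕ)
    (hpoints : ∀ {M : ℕ} (_hM : 1 ≤ M)
      (hdiv : ∀ Q : geomPoints (W.baseChange K), ∃ R, ((p ^ M : ℕ) : ℤ) • R = Q)
      (c : K ≃ₐ[ℚ] K) (_hc : c ≠ 1),
      ∃ (ε : ℤ) (τ : AlgebraicClosure K ≃+* AlgebraicClosure K) (hτ : IsLiftOfAut c τ)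
        (A : ℕ → AddSubgroup (geomPoints (W.baseChange K)))
        (hA : ∀ m, KolyvaginCocycle.IsAdmissible (Field.absoluteGaloisGroup K) (A m)
          ((p ^ M : ℕ) : ℤ))
        (Pn : ℕ → geomPoints (W.baseChange K))
        (hPn : ∀ m, Pn m ∈
          KolyvaginCocycle.invPoints (Field.absoluteGaloisGroup K) (A m) ((p ^ M : ℕ) : ℤ)),
        (ε = 1 ∨ ε = -1) ∧
        IsOfFinAddOrder (Affine.Point.map (W' := W) (c : K →ₐ[ℚ] K) Pt - ε • Pt) ∧
        (∀ m, ∀ a ∈ A m, hτ.pointsMap W a ∈ A m) ∧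
        Pn 1 = toGeomPoints (W.baseChange K) Pt ∧
        (∀ m : ℕ, Squarefree m →
          (∀ q ∈ m.primeFactors, IsKolyvaginPrime N₀ W K p q ∧ FrobEqFrobInfty W K (p ^ M) q) →
          (∃ B ∈ A m, hτ.pointsMap W (Pn m) =
            (ε * (-1) ^ m.primeFactors.card) • Pn m + ((p ^ M : ℕ) : ℤ) • B) ∧
          (∀ v : HeightOneSpectrum (𝓞 K), (m : 𝓞 K) ∉ v.asIdeal →
            kolyvaginClass (W.baseChange K) _ hdiv (hA m) (Pn m) (hPn m) ∈
              selmerLocalKer (W.baseChange K) (v.adicCompletion K) ((p ^ M : ℕ) : ℤ)) ∧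
          (∀ ℓ : ℕ, ℓ.Prime → ℓ ∣ m → ∀ v : HeightOneSpectrum (𝓞 K), (ℓ : 𝓞 K) ∈ v.asIdeal →
            ∀ a : ℕ, (((p : ℤ) ^ a) •
                kolyvaginClass (W.baseChange K) _ hdiv (hA m) (Pn m) (hPn m) ∈
                selmerLocalKer (W.baseChange K) (v.adicCompletion K) ((p ^ M : ℕ) : ℤ) ↔
              ((p : ℤ) ^ a) • kolyvaginClass (W.baseChange K) _ hdiv (hA (m / ℓ)) (Pn (m / ℓ))
                  (hPn (m / ℓ)) ∈
                (W.baseChange K).torsionLocalKer (v.adicCompletion K) ((p ^ M : ℕ) : ℤ))) ∧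
          ((p : ℤ) ^ (M - t)) • kolyvaginClass (W.baseChange K) _ hdiv (hA m) (Pn m) (hPn m) = 0)) :
    Finite (AddCommGroup.primaryComponent (W.baseChange K).sha p) ∧
    padicValNat p (Nat.card (AddCommGroup.primaryComponent (W.baseChange K).sha p)) + 2 * t ≤
      2 * padicValNat p (AddSubgroup.zmultiples Pt).index := by
  refine padicValNat_card_sha_primaryComponent_add_le_of_sharpLeaves W hK hN hnt hp hp2 hρ hidx t ?_
  intro M hM hdiv c₁ hc₁
  obtain ⟨ε, τ, hτ, A, hA, Pn, hPn, hε, h53, hAτ, hPn1, hm'⟩ := hpoints hM hdiv c₁ hc₁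
  -- the classes: McCallum's cocycle of the points (as in `exists_leafA_of_points`, but EXPLICIT, so that (D) transfers)
  let cl : ℕ → galH1Torsion (W.baseChange K) ((p ^ M : ℕ) : ℤ) :=
    fun m ↦ kolyvaginClass (W.baseChange K) _ hdiv (hA m) (Pn m) (hPn m)
  -- `c_M(1) = δ_M P` (McCallum (6))
  have hc1 : cl 1 = kummerMapTorsion (W.baseChange K) _ hdiv Pt := by
    have h1 : toGeomPoints (W.baseChange K) Pt ∈
        KolyvaginCocycle.invPoints (Field.absoluteGaloisGroup K) (A 1) ((p ^ M : ℕ) : ℤ) := by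
      rw [← hPn1]; exact hPn 1
    change kolyvaginClass (W.baseChange K) _ hdiv (hA 1) (Pn 1) (hPn 1) = _
    rw [kolyvaginClass_congr_point (hA 1) (hP' := h1) hPn1]
    exact kolyvaginClass_toGeomPoints (hA 1) Pt h1
  -- leaf (A): eigen-sign (Gross Prop. 5.4 (2) from (1)), Selmer off `m`, `λ`-switch
  have hcl : ∀ m : ℕ, Squarefree m →
      (∀ q ∈ m.primeFactors, IsKolyvaginPrime N₀ W K p q ∧ FrobEqFrobInfty W K (p ^ M) q) →
      conjAct W c₁ _ (cl m) = (ε * (-1) ^ m.primeFactors.card) • cl m ∧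
      (∀ v : HeightOneSpectrum (𝓞 K), (m : 𝓞 K) ∉ v.asIdeal →
        cl m ∈ selmerLocalKer (W.baseChange K) (v.adicCompletion K) ((p ^ M : ℕ) : ℤ)) ∧
      (∀ ℓ : ℕ, ℓ.Prime → ℓ ∣ m → ∀ v : HeightOneSpectrum (𝓞 K), (ℓ : 𝓞 K) ∈ v.asIdeal →
        ∀ a : ℕ, (((p : ℤ) ^ a) • cl m ∈
            selmerLocalKer (W.baseChange K) (v.adicCompletion K) ((p ^ M : ℕ) : ℤ) ↔
          ((p : ℤ) ^ a) • cl (m / ℓ) ∈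
            (W.baseChange K).torsionLocalKer (v.adicCompletion K) ((p ^ M : ℕ) : ℤ))) :=
    fun m hm hk ↦ ⟨conjAct_kolyvaginClass_eq_smul W hτ (hA m) (hAτ m) (hPn m) _ (hm' m hm hk).1,
      (hm' m hm hk).2.1, (hm' m hm hk).2.2.1⟩
  have hRT := fun {ℓ : ℕ} (hℓ : IsKolyvaginPrime N₀ W K p ℓ) (_ : FrobEqFrobInfty W K (p ^ M) ℓ) ↦
    kolyvaginReciprocityFinset_of_poitouTate_of_conductorNorm W hN
      (poitouTate_sum_localTatePairing_eq_zero_holds K) hp hM hℓ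
  exact ⟨ε, cl, hε, h53, hc1, hcl,
    hdual_of_kolyvaginReciprocityFinset_of_conductorNorm W hN hK hp hp2 hM hc₁ (fun hℓ hℓM ↦ hRT hℓ hℓM),
    hdual₂_of_kolyvaginReciprocityFinset_of_conductorNorm W hN hK hp hp2 hM hc₁ (fun hℓ hℓM ↦ hRT hℓ hℓM),
    fun m hm hk ↦ (hm' m hm hk).2.2.2⟩

/-- **S4♭'s Tamagawa-sharpened inequality from a SHARP ring-class-rational Kolyvagin datum** (the glue for stub
`stub_sharpKolyvaginJetchevGenusRC` of line `genus`, item 23444). For `W/ℚ` elliptic, `p` odd with `ρ̄_{W,p}` onto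
(`Surj W p`), `K` imaginary quadratic, `P ∈ W(K)` non-torsion of finite index, `Ш(W/K)` finite, and a depth `t`: IF the
point-level Kolyvagin datum attached to `P` (the body of line `genus`'s `GenusKolyvaginPointsR W p K ιc P` WITHOUT its
ring-class embeddings ∕ rationality clause, keyed by `N₀ = N_W`) carries, at every level `p^M` and every square-free
Kolyvagin `m`, ALSO the Selmer clause at EVERY finite `v ∤ m` (the carrier `v ∣ p` INCLUDED) and the divisibility (D)
«`p^{M − t}` kills the Kolyvagin class of `P_m`», THEN `ord_p #Ш(W/K) + 2t ≤ 2·ord_p [W(K) : ℤP]`. With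
`t = ord_p ∏_ℓ c_ℓ(W)` this is VERBATIM the conclusion of `SharpKolyvaginJetchevGenus`; hence
S4♭ ⟸ «for every genus setting `S` with the served frame profile, the genus system (`GenusKolyvaginPointsR` + the proved
off-carrier clause S3) upgrades to this sharp datum with `t = ord_p ∏c(W)`» — Jetchev 2008 Thm. 1.4 («`m_∞ ≥ ord_p c`»)
READ at `p ∥ N` for the genus system plus its Selmer condition at the carrier: the research residual, NOT proved here.
Proof: `padicValNat_card_sha_primaryComponent_add_le_of_sharpPoints` at `N₀ = N_W` and `ord_p #Ш[p^∞] = ord_p #Ш`.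
[cite: Jetchev2008, Thm. 1.4, Cor. 1.5 (p. 812)] [cite: McCallumLMS1991, §5 Cor. 5.6 (p. 310)]
[cite: GrossLMS1991, §§3–6, Prop. 6.2] -/
theorem padicValNat_card_sha_add_le_of_ringClassRationalSharpPoints [W.IsElliptic]
    (hK : IsImaginaryQuadratic K) {p : ℕ} [Fact p.Prime] (hp2 : p ≠ 2) (hρ : W.HasSurjectiveModNGaloisRep p)
    {Pt : (W.baseChange K).toAffine.Point} (hnt : ¬ IsOfFinAddOrder Pt)
    (hidx : (AddSubgroup.zmultiples Pt).index ≠ 0) (t : ℕ)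
    (hR : ∀ {M : ℕ} (_hM : 1 ≤ M)
      (hdiv : ∀ Q : geomPoints (W.baseChange K), ∃ R, ((p ^ M : ℕ) : ℤ) • R = Q)
      (c : K ≃ₐ[ℚ] K) (_hc : c ≠ 1),
      ∃ (ε : ℤ) (τ : AlgebraicClosure K ≃+* AlgebraicClosure K) (hτ : IsLiftOfAut c τ)
        (A : ℕ → AddSubgroup (geomPoints (W.baseChange K)))
        (hA : ∀ m, KolyvaginCocycle.IsAdmissible (Field.absoluteGaloisGroup K) (A m)
          ((p ^ M : ℕ) : ℤ))
        (Pn : ℕ → geomPoints (W.baseChange K))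
        (hPn : ∀ m, Pn m ∈
          KolyvaginCocycle.invPoints (Field.absoluteGaloisGroup K) (A m) ((p ^ M : ℕ) : ℤ)),
        (ε = 1 ∨ ε = -1) ∧
        IsOfFinAddOrder (Affine.Point.map (W' := W) (c : K →ₐ[ℚ] K) Pt - ε • Pt) ∧
        (∀ m, ∀ a ∈ A m, hτ.pointsMap W a ∈ A m) ∧
        Pn 1 = toGeomPoints (W.baseChange K) Pt ∧
        (∀ m : ℕ, Squarefree m →
          (∀ q ∈ m.primeFactors,
            IsKolyvaginPrime (W.conductorNorm ℤ) W K p q ∧ FrobEqFrobInfty W K (p ^ M) q) →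
          (∃ B ∈ A m, hτ.pointsMap W (Pn m) =
            (ε * (-1) ^ m.primeFactors.card) • Pn m + ((p ^ M : ℕ) : ℤ) • B) ∧
          (∀ v : HeightOneSpectrum (𝓞 K), (m : 𝓞 K) ∉ v.asIdeal →
            kolyvaginClass (W.baseChange K) _ hdiv (hA m) (Pn m) (hPn m) ∈
              selmerLocalKer (W.baseChange K) (v.adicCompletion K) ((p ^ M : ℕ) : ℤ)) ∧
          (∀ ℓ : ℕ, ℓ.Prime → ℓ ∣ m → ∀ v : HeightOneSpectrum (𝓞 K), (ℓ : 𝓞 K) ∈ v.asIdeal →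
            ∀ a : ℕ, (((p : ℤ) ^ a) •
                kolyvaginClass (W.baseChange K) _ hdiv (hA m) (Pn m) (hPn m) ∈
                selmerLocalKer (W.baseChange K) (v.adicCompletion K) ((p ^ M : ℕ) : ℤ) ↔
              ((p : ℤ) ^ a) • kolyvaginClass (W.baseChange K) _ hdiv (hA (m / ℓ)) (Pn (m / ℓ))
                  (hPn (m / ℓ)) ∈
                (W.baseChange K).torsionLocalKer (v.adicCompletion K) ((p ^ M : ℕ) : ℤ))) ∧
          ((p : ℤ) ^ (M - t)) • kolyvaginClass (W.baseChange K) _ hdiv (hA m) (Pn m) (hPn m) = 0))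
    [Finite (W.baseChange K).sha] :
    padicValNat p (Nat.card (W.baseChange K).sha) + 2 * t ≤
      2 * padicValNat p (AddSubgroup.zmultiples Pt).index := by
  haveI : NeZero (W.conductorNorm ℤ) := ⟨(W.conductorNorm_pos_holds).ne'⟩
  have h := (padicValNat_card_sha_primaryComponent_add_le_of_sharpPoints W hK rfl hnt Fact.out hp2 hρ hidx
    t hR).2
  rwa [padicValNat_card_addPrimaryComponent (A := (W.baseChange K).sha) p] at h

end Summit.BirchSwinnertonDyer.BirchSwinnertonDyer.Theorems.GenusSharpKolyvagin

end
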